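import Summits.Ventures.LatticeQCDFlow.Scoring.BesselIRatioPowerLimit
import Summits.Ventures.LatticeQCDFlow.Scoring.U1TorusPartitionFunctionBessel
import Summits.Ventures.LatticeQCDFlow.Scoring.SU2TorusPartitionFunction
import Mathlib.Analysis.SpecialFunctions.Gaussian.PoissonSummation
import HarnessLib

/-!
# The continuum limit of the 2-d `U(1)` and `SU(2)` lattice partition functions on the torus

HONEST FRAMING: exact (Metropolis-corrected) sampling algorithms for lattice gauge theory;
figures of merit are autocorrelation/cost numbers at stated couplings and volumes; no
continuum-physics claim.

Venture `LatticeQCDFlow` (cell pub-lqcd), sub-topic `Scoring`; FANOUT row 5 (`s0-sun-a`), GEN-15.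
NEW WORK of the cell (placement rule).  The tree holds the exact Wilson-action partition functions
of theory-2's Haar-measure lattice gauge theory on `(ℤ/L)²`:
`Z^{U(1)}_{L,β} = e^{−βL²} Σ_{n∈ℤ} I_{|n|}(β)^{L²}` (`Scoring/U1TorusPartitionFunctionBessel.lean`) and
`Z^{SU(2)}_{L,β} = (e^{−2β}/β)^{L²} Σ_{n∈ℕ} I_{n+1}(2β)^{L²}` (`Scoring/SU2TorusPartitionFunction.lean`).
Dividing by the `L²`-th power of the one-plaquette factor (`e^{−β} I₀(β)`, resp.
`e^{−2β} I₁(2β)/β` — the partition function of `L²` independent plaquettes) and letting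
`β_j → ∞`, `L_j → ∞` with **`L_j²/β_j → v`** (fixed area in units of the coupling):

* **`tendsto_tsum_besselI_ratio_pow`** — `Σ_{n∈ℤ} (I_{|n|}(β_j)/I₀(β_j))^{V_j} → Σ_{n∈ℤ} e^{−v n²/2}`
  (`V_j/β_j → v > 0`; termwise `Scoring/BesselIRatioPowerLimit.lean`, dominated convergence with
  the geometric majorant from Amos' Gaussian bounds);
* **`tendsto_u1_partitionFunction_div`** — `Z^{U(1)}_{L_j,β_j} / (e^{−β_j} I₀(β_j))^{L_j²} → Σ_{n∈ℤ} e^{−v n²/2}`;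
  `tsum_exp_neg_mul_sq_div_two` (Jacobi, Mathlib's Poisson summation):
  `Σ_{n∈ℤ} e^{−v n²/2} = √(2π/v) Σ_{k∈ℤ} e^{−2π²k²/v}` — the same limit written as a sum over
  topological sectors `k` with the continuum instanton action `2π²k²/v`;
* **`tendsto_tsum_besselI_succ_ratio_pow`**, **`tendsto_su2_partitionFunction_div`** —
  `Z^{SU(2)}_{L_j,β_j} / (e^{−2β_j} I₁(2β_j)/β_j)^{L_j²} → Σ_{n∈ℕ} e^{−v n(n+2)/4}`
  (`= Σ_{s ∈ ½ℕ} e^{−v s(s+1)}`, `s = n/2`).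

These are the genus-one continuum 2-d Yang–Mills partition functions `Σ_R e^{−(area)·C₂(R)}`
(`U(1)`: `R = n ∈ ℤ`, `C₂ = n²/2`; `SU(2)`: spin `s`, `C₂ = s(s+1)`) obtained as honest limits of
theory-2's lattice model; no continuum object is constructed and nothing is claimed beyond the
displayed limits.  Elementary given the parents; nothing is cited.  No sampler values.
-/

noncomputable section

open Real Filter Topology Set MeasureTheory
open scoped ENNReal
open Literature.Analysis.FunctionSpaces
open Literature.MathematicalPhysics.QuantumFieldTheory
open Literature.MathematicalPhysics.QuantumLattice

namespace Summit.Ventures.LatticeQCDFlow.Scoring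

/-! ### 0. Geometric majorants -/

/-- `Σ_{n∈ℕ} e^{−c n} < ∞` for `c > 0`. -/
theorem summable_exp_neg_mul_nat {c : ℝ} (hc : 0 < c) : Summable fun n : ℕ => Real.exp (-(c * n)) := by
  have h := Real.summable_exp_nat_mul_iff.2 (by linarith : -c < 0)
  refine h.congr fun n => ?_
  ring_nf

/-- `Σ_{n∈ℤ} e^{−c |n|} < ∞` for `c > 0`. -/
theorem summable_exp_neg_mul_natAbs {c : ℝ} (hc : 0 < c) :
    Summable fun n : ℤ => Real.exp (-(c * (n.natAbs : ℝ))) := by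
  refine summable_int_iff_summable_nat_and_neg.2 ⟨?_, ?_⟩
  · simpa using summable_exp_neg_mul_nat hc
  · simpa using summable_exp_neg_mul_nat hc

/-- Eventual consequences of `β_j → ∞`, `V_j/β_j → v > 0`: `β_j > 0`, `(v/2) β_j ≤ V_j ≤ 2v β_j`,
`2 ≤ V_j`. -/
theorem eventually_continuumLimit_bounds {β : ℕ → ℝ} {V : ℕ → ℕ} {v : ℝ} (hv0 : 0 < v)
    (hβ : Tendsto β atTop atTop) (hv : Tendsto (fun j => (V j : ℝ) / β j) atTop (𝓝 v)) :
    ∀ᶠ j in atTop, 0 < β j ∧ v / 2 * β j ≤ V j ∧ (V j : ℝ) ≤ 2 * v * β j ∧ 2 ≤ V j := by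
  have h1 := hv.eventually (eventually_ge_nhds (by linarith : v / 2 < v))
  have h2 := hv.eventually (eventually_le_nhds (by linarith : v < 2 * v))
  filter_upwards [h1, h2, hβ.eventually_gt_atTop 0, hβ.eventually_ge_atTop (4 / v)] with j hj1 hj2 hj0 hj4
  have hlo : v / 2 * β j ≤ V j := by
    have := (le_div_iff₀ hj0).1 hj1
    linarith
  have hhi : (V j : ℝ) ≤ 2 * v * β j := by
    have := (div_le_iff₀ hj0).1 hj2
    linarith
  refine ⟨hj0, hlo, hhi, ?_⟩
  have h4 : (2 : ℝ) ≤ v / 2 * β j := by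
    have := mul_le_mul_of_nonneg_left hj4 (by positivity : (0 : ℝ) ≤ v / 2)
    have e : v / 2 * (4 / v) = 2 := by field_simp; ring
    linarith
  exact_mod_cast h4.trans hlo

/-! ### 1. `U(1)` -/

/-- **`Σ_{n∈ℤ} (I_{|n|}(β_j)/I₀(β_j))^{V_j} → Σ_{n∈ℤ} e^{−v n²/2}`** when `β_j → ∞`, `V_j/β_j → v > 0`. -/
theorem tendsto_tsum_besselI_ratio_pow {β : ℕ → ℝ} {V : ℕ → ℕ} {v : ℝ} (hv0 : 0 < v)
    (hβ : Tendsto β atTop atTop) (hv : Tendsto (fun j => (V j : ℝ) / β j) atTop (𝓝 v)) :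
    Tendsto (fun j => ∑' n : ℤ, (besselI n.natAbs (β j) / besselI 0 (β j)) ^ V j) atTop
      (𝓝 (∑' n : ℤ, Real.exp (-(v * (n : ℝ) ^ 2 / 2)))) := by
  set c := min (v / 2 / 4) (1 / 2) with hc
  have hc0 : 0 < c := lt_min (by positivity) (by norm_num)
  refine tendsto_tsum_of_dominated_convergence
    (bound := fun n : ℤ => Real.exp c * Real.exp (-(c * (n.natAbs : ℝ)))) ?_ ?_ ?_
  · exact (summable_exp_neg_mul_natAbs hc0).mul_left _
  · intro n
    have h := tendsto_besselI_ratio_pow hβ hv 0 n.natAbs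
    have e : v * ((n.natAbs : ℝ) * (2 * ((0 : ℕ) : ℝ) + (n.natAbs : ℝ)) / 2) = v * (n : ℝ) ^ 2 / 2 := by
      rw [Nat.cast_zero, mul_zero, zero_add, Nat.cast_natAbs, Int.cast_abs, abs_mul_abs_self]
      ring
    simpa only [zero_add, e] using h
  · filter_upwards [eventually_continuumLimit_bounds hv0 hβ hv] with j hj n
    obtain ⟨hj0, hlo, -, h2⟩ := hj
    rw [Real.norm_of_nonneg (pow_nonneg (div_nonneg (besselI_pos _ hj0).le (besselI_pos 0 hj0).le) _)]
    exact besselI_ratio_zero_pow_le hj0 (by positivity) hlo h2 n.natAbs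

/-- **Jacobi's imaginary transformation** for the limit: `Σ_{n∈ℤ} e^{−v n²/2} = √(2π/v) Σ_{k∈ℤ} e^{−2π²k²/v}`
(`v > 0`; Mathlib's `Real.tsum_exp_neg_mul_int_sq` at `a = v/(2π)`). -/
theorem tsum_exp_neg_mul_sq_div_two {v : ℝ} (hv : 0 < v) :
    ∑' n : ℤ, Real.exp (-(v * (n : ℝ) ^ 2 / 2)) =
      Real.sqrt (2 * π / v) * ∑' k : ℤ, Real.exp (-(2 * π ^ 2 * (k : ℝ) ^ 2 / v)) := by
  have hπ : 0 < π := Real.pi_pos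
  have ha : 0 < v / (2 * π) := by positivity
  have h := Real.tsum_exp_neg_mul_int_sq ha
  have e1 : ∀ n : ℤ, Real.exp (-π * (v / (2 * π)) * (n : ℝ) ^ 2) = Real.exp (-(v * (n : ℝ) ^ 2 / 2)) :=
    fun n => by congr 1; field_simp
  have e2 : ∀ n : ℤ, Real.exp (-π / (v / (2 * π)) * (n : ℝ) ^ 2) =
      Real.exp (-(2 * π ^ 2 * (n : ℝ) ^ 2 / v)) := fun n => by congr 1; field_simp
  simp only [e1, e2] at h
  rw [h]
  congr 1
  rw [← Real.sqrt_eq_rpow, one_div, ← Real.sqrt_inv, inv_div]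

variable {L : ℕ → ℕ} [hNZ : ∀ j, NeZero (L j)]

/-- **THE CONTINUUM LIMIT OF THE 2-d `U(1)` PARTITION FUNCTION ON THE TORUS.**  If `β_j → ∞`,
`L_j ≥ 2` and `L_j²/β_j → v > 0`, then
`Z^{U(1)}_{L_j,β_j} / (e^{−β_j} I₀(β_j))^{L_j²} → Σ_{n∈ℤ} e^{−v n²/2}` (`= √(2π/v) Σ_k e^{−2π²k²/v}`). -/
theorem tendsto_u1_partitionFunction_div {β : ℕ → ℝ} {v : ℝ} (hv0 : 0 < v) (hL : ∀ j, 2 ≤ L j)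
    (hβ : Tendsto β atTop atTop) (hv : Tendsto (fun j => ((L j ^ 2 : ℕ) : ℝ) / β j) atTop (𝓝 v)) :
    Tendsto (fun j => (partitionFunction (d := 2) (L := L j) u1Rep (β j)).toReal /
        (Real.exp (-β j) * besselI 0 (β j)) ^ (L j ^ 2)) atTop
      (𝓝 (∑' n : ℤ, Real.exp (-(v * (n : ℝ) ^ 2 / 2)))) := by
  refine (tendsto_tsum_besselI_ratio_pow hv0 hβ hv).congr' ?_
  filter_upwards [hβ.eventually_gt_atTop 0] with j hj
  have hI0 : 0 < besselI 0 (β j) := besselI_pos 0 hj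
  rw [u1_partitionFunction_two_eq_besselI (β j) (hL j), ENNReal.toReal_ofReal]
  · rw [mul_pow, mul_div_mul_left _ _ (pow_ne_zero _ (Real.exp_pos _).ne'), ← tsum_div_const]
    exact tsum_congr fun n => by rw [div_pow]
  · exact mul_nonneg (by positivity) (tsum_nonneg fun n => pow_nonneg (besselI_pos _ hj).le _)

/-! ### 2. `SU(2)` -/

/-- **`Σ_{n∈ℕ} (I_{n+1}(2β_j)/I₁(2β_j))^{V_j} → Σ_{n∈ℕ} e^{−v n(n+2)/4}`** when `β_j → ∞`,
`V_j/β_j → v > 0`. -/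
theorem tendsto_tsum_besselI_succ_ratio_pow {β : ℕ → ℝ} {V : ℕ → ℕ} {v : ℝ} (hv0 : 0 < v)
    (hβ : Tendsto β atTop atTop) (hv : Tendsto (fun j => (V j : ℝ) / β j) atTop (𝓝 v)) :
    Tendsto (fun j => ∑' n : ℕ, (besselI (n + 1) (2 * β j) / besselI 1 (2 * β j)) ^ V j) atTop
      (𝓝 (∑' n : ℕ, Real.exp (-(v * (n : ℝ) * (n + 2) / 4)))) := by
  -- the sequence `x_j = 2β_j`, `V_j/x_j → v/2`
  have hx : Tendsto (fun j => 2 * β j) atTop atTop := hβ.const_mul_atTop (by norm_num)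
  have hvx : Tendsto (fun j => (V j : ℝ) / (2 * β j)) atTop (𝓝 (v / 2)) := by
    have := hv.div_const 2
    refine this.congr fun j => ?_
    rw [div_div]; ring_nf
  have hv2 : 0 < v / 2 := by positivity
  set c := min (v / 2 / 2 / 4) (1 / 2) with hc
  have hc0 : 0 < c := lt_min (by positivity) (by norm_num)
  refine tendsto_tsum_of_dominated_convergence
    (bound := fun n : ℕ => Real.exp (2 * (v / 2)) * Real.exp (-(c * n))) ?_ ?_ ?_
  · exact (summable_exp_neg_mul_nat hc0).mul_left _
  · intro n
    have h := tendsto_besselI_ratio_pow hx hvx 1 n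
    have e : v / 2 * ((n : ℝ) * (2 * ((1 : ℕ) : ℝ) + n) / 2) = v * (n : ℝ) * (n + 2) / 4 := by
      push_cast; ring
    rw [e] at h
    simpa only [add_comm 1 n] using h
  · filter_upwards [eventually_continuumLimit_bounds hv2 hx hvx] with j hj n
    obtain ⟨hj0, hlo, hhi, h2⟩ := hj
    rw [Real.norm_of_nonneg (pow_nonneg (div_nonneg (besselI_pos _ hj0).le (besselI_pos 1 hj0).le) _)]
    exact besselI_ratio_one_pow_le hj0 (by positivity) hlo hhi h2 n

/-- **THE CONTINUUM LIMIT OF THE 2-d `SU(2)` PARTITION FUNCTION ON THE TORUS.**  If `β_j → ∞` and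
`L_j²/β_j → v > 0`, then `Z^{SU(2)}_{L_j,β_j} / (e^{−2β_j} I₁(2β_j)/β_j)^{L_j²} → Σ_{n∈ℕ} e^{−v n(n+2)/4}`. -/
theorem tendsto_su2_partitionFunction_div {β : ℕ → ℝ} {v : ℝ} (hv0 : 0 < v)
    (hβ : Tendsto β atTop atTop) (hv : Tendsto (fun j => ((L j ^ 2 : ℕ) : ℝ) / β j) atTop (𝓝 v)) :
    Tendsto (fun j => (partitionFunction (d := 2) (L := L j) (fundamentalRep (Fin 2)) (β j)).toReal /
        (Real.exp (-(2 * β j)) * besselI 1 (2 * β j) / β j) ^ (L j ^ 2)) atTop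
      (𝓝 (∑' n : ℕ, Real.exp (-(v * (n : ℝ) * (n + 2) / 4)))) := by
  refine (tendsto_tsum_besselI_succ_ratio_pow hv0 hβ hv).congr' ?_
  filter_upwards [hβ.eventually_gt_atTop 0] with j hj
  have hI1 : 0 < besselI 1 (2 * β j) := besselI_pos 1 (by linarith)
  rw [partitionFunction_su2_two_toReal_eq_mul_tsum hj]
  have e : (Real.exp (-(2 * β j)) * besselI 1 (2 * β j) / β j) ^ (L j ^ 2) =
      (Real.exp (-(2 * β j)) / β j) ^ (L j ^ 2) * besselI 1 (2 * β j) ^ (L j ^ 2) := by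
    rw [← mul_pow]; ring
  rw [e, mul_div_mul_left _ _ (by positivity), ← tsum_div_const]
  exact tsum_congr fun n => by rw [div_pow]

end Summit.Ventures.LatticeQCDFlow.Scoring
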